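import Summits.BirchSwinnertonDyer.Rank1Residual.X11b.Three.ClassRecordAtThree
import HarnessLib

/-!
# Class X11b at `p = 3` (team N8/O2 = cell `b2b-bsdres`, seat x11b3-p8, lead deal #4 (R2), S12), file 1/3:
# the (T4″)@3 CORNER ∧ SPLIT(3) — THE typed residual `CornerSplitResidualAt` (ONE shape-only decl)

HONEST FRAMING (verbatim, cell `b2b-bsdres`, run/shared/lean/b2b/bsd-rank1-residual/): the goal of
the cell is to DELETE the COMBINATION-SHAPED residual classes for ALL analytic-rank `≤ 1` curves
over `ℚ` — "full BSD formula for every rank `≤ 1` curve in class `C`" assembled STRICTLY from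
published theorems — so that the rank-`≤ 1` remainder becomes exactly the CONSTRUCTION-SHAPED
classes, which are TYPED (missing-input Props), NOT attempted; this is not "finishing BSD".
Research route; nothing booked; NO label changes; census numbers are EVIDENCE (x11b3-p6's CORNER
CENSUS, `cells/x11b3/CORNER-CENSUS.md`, two engines), never facts. ONE shape-only `Prop`-valued
predicate (`CornerSplitResidualAt`, tagged `@[conjecture]`: implied by BSD, nothing asserted), its
unfolding, and the kernel anatomy of the cells; NO named fact; no `sorry`. The theorems that USE the
residual (⇒ `BSD(E,3)`, the binder `hCs` of x11b3-p3's `Three.forall_bsdp_of_classRecord`, the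
per-binder restatement of road (b) without `Surj`, tightness) are file 2/3 `CornerSplitResidual.lean`;
what the PRINTED irreducible-image Kolyvagin bound (Matar–Nekovář 2019 / Cha 2005) buys on the corner
is file 3/3 `CornerMatarNekovar.lean`.

## The cells (kernel anatomy, `shapeAlpha_of_corner_split`)

`(E, 3) ∈` X11b (`r_an = 1`, `3 ∥ N`, `E[3]` irreducible) with `ρ̄_{E,3}` NOT onto `GL₂(𝔽₃)` (the
(T4″)@3 corner: image a `2`-group in the normaliser of a Cartan, labels 3Ns / 3Nn) and `E` SPLIT
multiplicative at `3`. In the kernel: `¬ Surj ∧ (irr) ⇒ 3 ∣ ord₃ Δ_min ∧ ¬ Ram`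
(`ClassX11b.dvd_and_not_ram_of_not_surj`; x11b3-p3's correction of record: "corner ∧ Ram" is
EMPTY), hence split ⇒ `ShapeAlpha W` ((T2α)@3: `c₃ = ord₃ Δ_min ≡ 0 mod 3`) and `3 ∣ ∏_ℓ c_ℓ(E)`
ALWAYS. Census: 129 class-pairs (3Ns 76 / 3Nn 53; `v₃(Δ) ∈ {3,…,21}`), `Ram = 0` on 129/129,
0 TRUE-OPEN (all per-pair closed) — the residual matters ONLY for the `∀ E` class theorem
`Three.forall_bsdp_of_classRecord` (x11b3-p3, p252266), whose binder `hCs` it replaces.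

## Road (b)'s end state, binder by binder, and what survives WITHOUT `Surj W 3` / `Ram W 3`

Road (b) (split(3) ∧ (ram), `bsdp_three_of_surj_of_stepLAt_of_shapes`) proves `BSD(E,3)` as
LOWER half (`ord₃ #Ш_an ≤ ord₃ #Ш`) + UPPER half, each over a Heegner field `K` and descended to `ℚ`
through the rank-`0` twist `E^{d_K}` (Jetchev–Skinner–Wan 2017 §7.4.1/§7.4.2). Per binder:
* (b-L1) STEP L at an odd-`d_K` Manin-good Heegner datum, S0 currency `StepLAt W` = "(IMC≥)∘(BDP)"
  — its datum CARRIES `Surj W 3` [no source at `3` even with `Surj`; every printed anticyclotomic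
  divisibility (Howard 2004 "`Gal(K̄/K) → Aut(T)` surjective", Castella 2018, FW21) has big image].
  CORNER: the same inequality at a NON-surjective datum — conjunct (R-L) `IndexLowerBoundAt W 3 K P`;
  the passage S0-currency ⇒ (R-L) is image-free (`indexLowerBoundAt_of_heegner_of_openInput_prime`
  needs (irr) only), so (R-L) is literally "`StepLAt` minus `Surj`" [NO source].
* (b-L2) the twist's `≤`-half `ord₃ #Ш(E^{d_K}) ≤ ord₃ (L(E^{d_K},1)/Ω)`: Wuthrich 2014 Prop. 21
  [PUB; image surjective-or-Borel at `3`]. CORNER: `ρ̄_{E^{d},3} = ρ̄_{E,3} ⊗ χ_d` is irreducible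
  non-surjective ("exotic") ⇒ Prop. 21's constant `C` may contain `3` ⇒ EXCLUDED [NO source;
  Kato 2004 Thm. 17.4 needs image `⊇ SL₂(ℤ₃)`; `E` is non-CM since `3 ∥ N`].
* (b-U1) Kolyvagin's bound over `K`, `ord₃ #Ш(E/K) ≤ 2·ord₃ [E(K):ℤP_K]`: McCallum 1991 §1
  [PUB, `Surj`]. CORNER: the PRINTED IRREDUCIBLE-IMAGE SUBSTITUTE EXISTS — Matar–Nekovář 2019
  Thm. 0.3 + §0.11 (Prop. 5.26 (2), Cor. 5.21 (e′)) = tree fact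
  `MatarNekovar2019.thm03_padicValNat_card_sha_le_of_irreducible` (flag-free of record); Cha 2005
  Thm. 21 ("`ℓ ∤ D_K`, good or multiplicative at `ℓ`") ✓ at `3 ∥ N` too (harvest-2 E69 review). BUT
  Kolyvagin's shape is blind to the Tamagawa term `2·ord₃ ∏_ℓ c_ℓ(E)` of BSD over `K`, and on
  corner ∧ split that term is `≥ 2·ord₃ c₃ ≥ 2` ALWAYS: the printed bound yields only the DEFECT
  form `ord₃ #Ш(E) ≤ ord₃ #Ш_an(E) + 2·ord₃ ∏c_ℓ(E)` (file 3/3) — enough on corner ∧ `3 ∤ ∏c` (88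
  class-pairs, all NON-split), NOT on corner ∧ split, which needs the Tamagawa-SHARP shape (R-U♯)
  `ord₃ #Ш(E/K) + 2·ord₃ ∏c_ℓ(E) ≤ 2·ord₃ [E(K):ℤP]` [NO source: Jetchev 2008's sharpening is printed
  for `p ∤ N` AND `ρ̄` surjective — fails twice; = the (T2α)@3 binder `hUα` of the class record
  restated WITHOUT `Ram`/`Surj`].
* (b-U2) the twist's `≥`-half: Skinner 2016 Thm. C [(irr)+(ram) for `E^{d_K}` ⇐ `Ram W 3`].
  CORNER: `¬Ram(E) ⇒ ¬Ram(E^{d_K})` (same `v_ℓ(Δ)` off `d_K`) ⇒ EXCLUDED, also SU14 Thm. 2 [NO source].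
* GZ, GZK, Kolyvagin's finiteness, modularity, Hoffstein–Luo, Mazur Cor. 4.1, Néron: image-free ✓.
(b-L2) ∧ (b-U2) = the rank-`0` print shape `PPartRankZero Wd 3` of the twist — conjunct (R-Tw); the
twist is itself split multiplicative at `3` (`3` splits in `K`), exotic at `3`, without (ram): the
rank-`0` analogue of this corner. (R-L) ∧ (R-U♯) = `IndexIdentityAt W 3 K P` = `BSD₃(E/K)` in Gross's
Heegner-index form. TIGHT (file 2/3): `BSD(E,3)` + the twists' `3`-parts give the residual back.

References: [MatarNekovar2019] Thm. 0.3, §0.11, Prop. 5.26 (2), Cor. 5.21 (e′); [Cha2005] Thm. 21,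
Rmk. 25; [JetchevSkinnerWan2017] §7.2 Thm. 7.2.1, §7.4.1–7.4.2; [Wuthrich2014] Prop. 21;
[Skinner2016PacificMC] Thm. C; [Jetchev2008] Thm. 1.1; [McCallumLMS1991] §1; [GrossLMS1991] Thm. 1.3,
(2.2); [Miller2011LMS] Def. 1.1; cells/x11b3/CORNER-CENSUS.md §2–§4.
-/

noncomputable section

open scoped Classical

open WeierstrassCurve NumberField IsDedekindDomain Field Literature.NumberTheory.EllipticCurves
  Rat.HeightOneSpectrum
  Literature.NumberTheory.DiophantineGeometry
  Literature.NumberTheory.EllipticCurves.GreenbergSelmer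
  Literature.NumberTheory.EllipticCurves.ModularForms
  Literature.NumberTheory.EllipticCurves.Rank1Residual
  Literature.NumberTheory.EllipticCurves.Rank1Residual.Typed
  Literature.NumberTheory.EllipticCurves.Wuthrich2014
  Literature.NumberTheory.EllipticCurves.BalakrishnanEtAl2019
  Literature.NumberTheory.EllipticCurves.Skinner2016
  Literature.NumberTheory.QuadraticFields.Quadratic
  Literature.NumberTheory.Automorphic
  Literature.NumberTheory.GaloisRepresentations Literature.NumberTheory.GaloisCohomology
  Summit.BirchSwinnertonDyer.Rank1Residual.X11b.AcSelmer
  Summit.BirchSwinnertonDyer.Rank1Residual.X11b.LocBridge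

namespace Summit.BirchSwinnertonDyer.Rank1Residual.X11b.Three

/-! ### §1. Kernel anatomy of corner ∧ split(3) -/

/-- **Corner ∧ split(3) cells are (T2α)-shaped, off (ram), with `3 ∣ ∏_ℓ c_ℓ`.** On X11b@3,
`¬ Surj W 3` forces `3 ∣ ord₃ Δ_min` and `¬ Ram W 3` (`ClassX11b.dvd_and_not_ram_of_not_surj`:
(irr) ∧ (ram) ⇒ `Surj`); with split multiplicative reduction at `3` this is `ShapeAlpha W`
(`c₃ = ord₃ Δ_min`, Kodaira–Néron), hence `3 ∣ ∏_ℓ c_ℓ(E)` (`three_dvd_tamagawaProduct_iff_shapes`).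
So on these cells Skinner 2016 Thm. C (needs (ram)) and the A1 shortcut `3 ∤ ∏c` are BOTH void, and
Kolyvagin's unsharpened bound over `K` carries a defect `2·ord₃ ∏c_ℓ ≥ 2`. Census (EVIDENCE,
CORNER-CENSUS §2): 129/129 split corner pairs have `c₃ = v₃(Δ) ∈ {3, 6, …, 21}`, `Ram = 0`.
[cite: SilvermanATAEC1994, Cor. IV.9.2(d) (PDF p. 340)] [cite: Serre1972, §2.4 Prop. 15] -/
theorem shapeAlpha_of_corner_split [Fact (Nat.Prime 3)] (W : WeierstrassCurve ℚ) [W.IsElliptic]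
    [W.IsGloballyMinimal] (hX : ClassX11b W 3) (hns : ¬ Surj W 3)
    (hs : W.HasSplitMultiplicativeReductionAtPrime 3) :
    ShapeAlpha W ∧ ¬ Ram W 3 ∧ 3 ∣ W.tamagawaProduct := by
  obtain ⟨hdvd, hnr⟩ := ClassX11b.dvd_and_not_ram_of_not_surj W 3 hX hns
  have hα : ShapeAlpha W := ⟨hs, hdvd⟩
  exact ⟨hα, hnr, (three_dvd_tamagawaProduct_iff_shapes W).mpr (Or.inl hα)⟩

/-! ### §2. THE typed residual on corner ∧ split(3) -/

/-- OPEN (typed residual; a CONJECTURE implied by BSD, `cornerSplitResidualAt_of_bsdp_of_twists`) —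
**(T4″)@3 CORNER ∧ SPLIT(3) — THE typed residual (team x11b3, S12; ONE decl, nothing asserted).**
For `W/ℚ` globally minimal: IF `(E,3) ∈` X11b, `ρ̄_{E,3}` is NOT surjective and `E` is
split multiplicative at `3` (so `3 ∣ c₃ = ord₃ Δ_min`, `¬Ram`: `shapeAlpha_of_corner_split`), THEN at
every odd-`d_K` Manin-good Heegner datum of `E` — `K` imaginary quadratic, `d_K` odd, Heegner for
`N = N_E`, `L(E^{d_K},1) ≠ 0`; `Dt` a modular parametrisation of level `N_E` with `3 ∤ c(Dt)`; `P ∈ E(K)`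
THE Heegner point of `(Dt, H, ι)`, of infinite order, `Ш(E/K)` finite (both THEOREMS at such data:
Gross–Zagier, Kolyvagin); `Wd = Cd • E^{(d_K)}` a globally minimal model of the twist — EXACTLY the
datum of S0's `StepLAt W` WITHOUT its antecedent `Surj W 3`:
* (R-L) `IndexLowerBoundAt W 3 K P`: `2·ord₃ [E(K):ℤP] ≤ ord₃ #Ш(E/K) + 2·ord₃ ∏_ℓ c_ℓ(E)` — STEP L
  = (IMC≥)∘(BDP) read through Gross–Zagier [road (b): `StepLAt W`, whose datum carries `Surj`; NO
  source at `3`; on the corner additionally NO printed anticyclotomic divisibility for a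
  Cartan-normaliser image at any `p`];
* (R-U♯) `ord₃ #Ш(E/K) + 2·ord₃ ∏_ℓ c_ℓ(E) ≤ 2·ord₃ [E(K):ℤP]` — the Tamagawa-SHARP Kolyvagin bound
  [road (b): Kolyvagin (McCallum 1991 §1, `Surj`) on A1, the (T2α)@3 binder `hUα` on `3 ∣ c₃`;
  PRINTED under (irr) WITHOUT the sharpening: Matar–Nekovář 2019 Thm. 0.3 + §0.11 / Cha 2005
  Thm. 21 (tree fact `MatarNekovar2019.thm03_padicValNat_card_sha_le_of_irreducible`), which on
  these cells leaves the defect `2·ord₃ ∏c_ℓ ≥ 2·ord₃ c₃ ≥ 2` (file 3/3 `CornerMatarNekovar.lean`); the sharpening has NO source: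
  Jetchev 2008 is `p ∤ N` and `ρ̄` onto];
* (R-Tw) `PPartRankZero Wd 3`: `ord₃ (L(E^{d_K},1)/Ω) = ord₃ #Ш(E^{d_K}) + ord₃ ∏c_ℓ(E^{d_K}) −
  2·ord₃ #E^{d_K}(ℚ)_tors` — the rank-`0` `3`-part of the twist [road (b): `≤` Wuthrich 2014 Prop. 21
  (surjective-or-Borel image — the twist of a corner curve is EXOTIC at `3`: excluded), `≥` Skinner
  2016 Thm. C ((ram) — `¬Ram`: excluded); NO source for either half; the twist is split
  multiplicative at `3`, exotic, without (ram): the rank-`0` analogue of this corner].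
(R-L) ∧ (R-U♯) is `IndexIdentityAt W 3 K P` (`BSD₃(E/K)` in Gross's Heegner-index form). The residual
gives `BSD(E,3)` (`bsdp_of_corner_split`, file 2/3) and is given back by `BSD(E,3)` + the twists'
`3`-parts (`cornerSplitResidualAt_of_bsdp_of_twists`, file 2/3): TIGHT, nothing beyond BSD is asked. Census reach
(EVIDENCE): 129 class-pairs, 0 TRUE-OPEN. A predicate; NEVER a theorem in this cell; every result
using it is CONDITIONAL; X11 ∧ `r = 1` ∧ `p = 3` stays CONSTRUCTION-SHAPED (R6.2); O2 OPEN.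
[cite: JetchevSkinnerWan2017, §7.4.1 (eq:shalowerK-1) and §7.4.2 (eq:shaupper), pp. 30–31; Thm. 7.2.1 (shape)]
[cite: MatarNekovar2019, Thm. 0.3 (p. 456) and §0.11 (p. 457) (the unsharpened printed bound)]
[cite: GrossLMS1991, §2 Conj. (2.2) (shape)] [cite: Skinner2016PacificMC, Thm. C (display; shape only)] -/
@[conjecture] def CornerSplitResidualAt (W : WeierstrassCurve ℚ) [W.IsElliptic] [W.IsGloballyMinimal] : Prop :=
  ClassX11b W 3 → ¬ Surj W 3 → W.HasSplitMultiplicativeReductionAtPrime 3 →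
  ∀ (N : ℕ) [NeZero N] (K : Type) [Field K] [NumberField K]
    (Dt : ModularParametrizationData W N) (H : HeegnerDatum N (NumberField.discr K)) (ι : K →+* ℂ)
    (P : (W.baseChange K).toAffine.Point)
    (Wd : WeierstrassCurve ℚ) [Wd.IsElliptic] [Wd.IsGloballyMinimal] (Cd : VariableChange ℚ),
    W.conductorNorm ℤ = N → IsImaginaryQuadratic K → Odd (NumberField.discr K) →
    SatisfiesHeegnerHypothesis N K →
    (W.quadraticTwist (NumberField.discr K : ℚ)).entireLFunction 1 ≠ 0 →
    WeierstrassCurve.Affine.Point.map ι.toRatAlgHom P = heegnerPointComplex Dt H →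
    ¬ (3 : ℤ) ∣ Dt.c → ¬ IsOfFinAddOrder P → Finite (W.baseChange K).sha →
    Cd • W.quadraticTwist (NumberField.discr K : ℚ) = Wd →
    -- (R-L) STEP L at the datum — NO `Surj` antecedent
    IndexLowerBoundAt W 3 K P ∧
    -- (R-U♯) the Tamagawa-SHARP Kolyvagin bound over `K` — NO `Surj` antecedent
    padicValNat 3 (W.baseChange K).shaOrder + 2 * padicValNat 3 W.tamagawaProduct ≤
        2 * padicValNat 3 (AddSubgroup.zmultiples P).index ∧
    -- (R-Tw) the rank-`0` `3`-part of the twist `E^{d_K}`, print shape — NO image / (ram) antecedent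
    PPartRankZero Wd 3

/-- Unfolding of `CornerSplitResidualAt`. [folklore] -/
theorem cornerSplitResidualAt_iff (W : WeierstrassCurve ℚ) [W.IsElliptic] [W.IsGloballyMinimal] :
    CornerSplitResidualAt W ↔
      (ClassX11b W 3 → ¬ Surj W 3 → W.HasSplitMultiplicativeReductionAtPrime 3 →
      ∀ (N : ℕ) [NeZero N] (K : Type) [Field K] [NumberField K]
        (Dt : ModularParametrizationData W N) (H : HeegnerDatum N (NumberField.discr K)) (ι : K →+* ℂ)
        (P : (W.baseChange K).toAffine.Point)
        (Wd : WeierstrassCurve ℚ) [Wd.IsElliptic] [Wd.IsGloballyMinimal] (Cd : VariableChange ℚ),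
        W.conductorNorm ℤ = N → IsImaginaryQuadratic K → Odd (NumberField.discr K) →
        SatisfiesHeegnerHypothesis N K →
        (W.quadraticTwist (NumberField.discr K : ℚ)).entireLFunction 1 ≠ 0 →
        WeierstrassCurve.Affine.Point.map ι.toRatAlgHom P = heegnerPointComplex Dt H →
        ¬ (3 : ℤ) ∣ Dt.c → ¬ IsOfFinAddOrder P → Finite (W.baseChange K).sha →
        Cd • W.quadraticTwist (NumberField.discr K : ℚ) = Wd →
        IndexLowerBoundAt W 3 K P ∧
        padicValNat 3 (W.baseChange K).shaOrder + 2 * padicValNat 3 W.tamagawaProduct ≤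
            2 * padicValNat 3 (AddSubgroup.zmultiples P).index ∧
        PPartRankZero Wd 3) :=
  Iff.rfl

end Summit.BirchSwinnertonDyer.Rank1Residual.X11b.Three

end
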